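import Summits.HodgeConjecture.HodgeConjecture.Theses.SecondaryPeriods
import Literature.Barriers.HodgeConjecture.GeneralizedHodgeTrivialReasonsHolds
import Literature.AlgebraicGeometry.HodgeTheory.HodgeTypeProjectors
import Literature.AlgebraicGeometry.HodgeTheory.HodgeTypeConjugation

/-!
# Route `SecondaryPeriods`, crux `ConiveauOneFailure` (stmt-HodgeConjecture-3540): the sub-Hodge
# binder of the crux is LOAD-BEARING — without it the crux holds "for trivial reasons" (`E_τ³`)

`ConiveauOneFailure = ¬ LevelOneConiveauThreefolds`, and `LevelOneConiveauThreefolds` (GHC(3,1) for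
smooth projective threefolds) quantifies over finite sets `s` of rational classes of `H³(Y(ℂ); ℂ)`
subject to TWO binders: (i) the span of `s`, pulled back to a Hodge model `A`, is a sub-Hodge
structure (`= ⨆_{p+q=3} span s ∩ H^{p,q}`), and (ii) it has Hodge level one
(`⊆ ⨆_{p+q=3, p ≥ 1, q ≥ 1} H^{p,q} = H^{2,1} ⊕ H^{1,2}`). This file proves that binder (i) cannot
be dropped: the variant of `LevelOneConiveauThreefolds` with (ii) alone is FALSE — so the variant
of the crux with (ii) alone is TRUE for Grothendieck's "trivial reasons" and says nothing about the
Hodge conjecture. This is the catalogued barrier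
`Literature.Barriers.HodgeConjecture.Grothendieck1969_generalHodgeConjecture_false` (Hodge's original
general conjecture fails on `E_τ³`, `τ` cubic: a rational class of `F¹H³` outside `N¹H³`; PROVED in
the tree, `…_holds`), transported to the crux's binder shape by one Hodge-theoretic lemma proved
here: **a real (e.g. rational) class of `Fʳ Hᵏ` has Hodge coniveau `≥ r`**, i.e. lies in
`⨆_{p, q ≥ r} H^{p,q} = Fʳ ∩ conj Fʳ` (Hodge symmetry `conj H^{p,q} = H^{q,p}`,
`HodgeModel.isHodgeSymmetric`, read through the type projectors `HodgeModel.typeProj`).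

* (`HodgeModel.typeProj_eq_zero_of_mem_hodgeFiltration`, tree) — `π_{(p,q)} c = 0` for `p < r` when
  `A^* c ∈ Fʳ`;
* `conjClass_typeProj_of_conjClass_eq` — for a real class, `conj π_{(p,q)} c = π_{(q,p)} c`;
* `pullback_mem_hodgeConiveau_of_conjClass_eq` — a real class of `Fʳ` has Hodge coniveau `≥ r`;
* `levelOneConiveauThreefolds_false_without_isSubHodge` — **binder (i) is load-bearing**: it is
  NOT true that every finite set of rational classes of `H³` of a smooth projective threefold whose
  span has Hodge level one spans a subspace of `N¹H³` (witness `E_τ³`, `τ` cubic, Grothendieck 1969);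
* `coniveauOneFailure_variant_without_isSubHodge` — the same, read as the "trivial" truth of the
  crux's variant; with binder (i) the statement is Grothendieck's AMENDED conjecture, open (the
  crux pair), and nothing here bears on it beyond `levelOneConiveauThreefolds_of_variant_without_isSubHodge`
  (the typed GHC(3,1) is WEAKER than the refuted variant).

## References

* [GrothendieckTopology1969] A. Grothendieck, Hodge's general conjecture is false for trivial
  reasons, Topology 8 (1969), pp. 299–300.
* [VoisinHodgeI2002] C. Voisin, Hodge Theory and Complex Algebraic Geometry I, §6.1.3 Cor. 6.12,
  Thm. 6.18, §7.1.1, §11.3.2 p. 235.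
-/

noncomputable section

-- every declaration of this problem lives in `Summit.HodgeConjecture.HodgeConjecture.…` (summit = sub-problem), which `linter.dupNamespace` flags
set_option linter.dupNamespace false

namespace Summit.HodgeConjecture.HodgeConjecture.Theorems

open Literature.AlgebraicGeometry.Motives Literature.AlgebraicGeometry.HodgeTheory
  Literature.AlgebraicTopology.SingularHomology
open Literature.Barriers.HodgeConjecture (Grothendieck1969_generalHodgeConjecture_false_holds)
open Summit.HodgeConjecture.HodgeConjecture.Theses.SecondaryPeriods (LevelOneConiveauThreefolds
  ConiveauOneFailure)

variable {n : ℕ} {X : SchemeOver ℂ}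

/-! ### Type projectors of classes in `Fʳ` and of real classes -/

/-- **For a real class, conjugation swaps the type components: `conj π_{(p,q)} c = π_{(q,p)} c`.**
Since `conj c = c` and `conj` maps the `(q, p)`-piece to the `(p, q)`-piece (Hodge symmetry of every
Hodge model of a smooth projective variety, `HodgeModel.isHodgeSymmetric`, Voisin I Cor. 6.12),
`c = conj c = Σ_{(p,q)} conj π_{(q,p)} c` is another type decomposition of `c`; by uniqueness
(`typeProj_eq_of_sum_eq`) its terms are the `π_{(p,q)} c`. [cite: VoisinHodgeI2002, §6.1.3 Cor. 6.12 and Thm. 6.18] -/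
theorem conjClass_typeProj_of_conjClass_eq (hX : IsSmoothProjective n X) (A : HodgeModel n X) {k : ℕ}
    {c : complexBetti X k} (hc : conjClass (ComplexPoints X) k c = c)
    (pq : ↥(Finset.HasAntidiagonal.antidiagonal k)) :
    conjClass (ComplexPoints X) k (A.typeProj k pq c) =
      A.typeProj k ⟨pq.1.swap, Finset.HasAntidiagonal.swap_mem_antidiagonal.2 pq.2⟩ c := by
  -- the swap `(p, q) ↦ (q, p)` of the antidiagonal, an involution
  set σ : ↥(Finset.HasAntidiagonal.antidiagonal k) → ↥(Finset.HasAntidiagonal.antidiagonal k) :=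
    fun pq' ↦ ⟨pq'.1.swap, Finset.HasAntidiagonal.swap_mem_antidiagonal.2 pq'.2⟩ with hσ
  have hσσ : ∀ pq', σ (σ pq') = pq' := fun _ ↦ Subtype.ext (Prod.swap_swap _)
  -- the candidate decomposition `y_{(p,q)} = conj π_{(q,p)} c`
  set y : ↥(Finset.HasAntidiagonal.antidiagonal k) → complexBetti X k :=
    fun pq' ↦ conjClass (ComplexPoints X) k (A.typeProj k (σ pq') c) with hy
  have hymem : ∀ pq', y pq' ∈ A.typePiece k pq' := by
    intro pq'
    rw [HodgeModel.mem_typePiece_iff, hy, A.pullback_conjClass]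
    exact A.isHodgeSymmetric hX k _ _ _ (A.typeProj_mem k (σ pq') c)
  have hysum : ∑ pq', y pq' = c := by
    have hswap : ∑ pq', A.typeProj k (σ pq') c = ∑ pq', A.typeProj k pq' c :=
      Fintype.sum_equiv ⟨σ, σ, hσσ, hσσ⟩ _ _ fun _ ↦ rfl
    calc ∑ pq', y pq' = conjClassEquiv (ComplexPoints X) k (∑ pq', A.typeProj k (σ pq') c) := by
          rw [map_sum]; rfl
      _ = c := by rw [hswap, A.sum_typeProj, conjClassEquiv_apply, hc]
  have h := A.typeProj_eq_of_sum_eq hymem hysum (σ pq)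
  -- `π_{(q,p)} c = conj π_{(p,q)} c`; conjugate both sides
  rw [hy] at h
  simp only [hσσ] at h
  rw [h]

/-- **A real class of `Fʳ Hᵏ` has Hodge coniveau `≥ r`**: if `conj c = c` (e.g. `c` rational,
`IsRationalClass.conjClass_eq`) and `A^* c ∈ Fʳ Hᵏ = ⨆_{p ≥ r} H^{p,q}`, then
`A^* c ∈ ⨆_{p ≥ r, q ≥ r} H^{p,q}` (`= Fʳ ∩ conj Fʳ`): the components `π_{(p,q)} c` with `p < r`
vanish (`typeProj_eq_zero_of_mem_hodgeFiltration`), those with `q < r` are conjugates of components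
with `p < r` (`conjClass_typeProj_of_conjClass_eq`), and `c = Σ π_{(p,q)} c`.
[cite: VoisinHodgeI2002, §6.1.3 Cor. 6.12 and §7.1.1] [cite: GrothendieckTopology1969, p. 300] -/
theorem pullback_mem_hodgeConiveau_of_conjClass_eq (hX : IsSmoothProjective n X) (A : HodgeModel n X)
    {k r : ℕ} {c : complexBetti X k} (hreal : conjClass (ComplexPoints X) k c = c)
    (hF : A.pullback k c ∈ A.hodgeFiltration k r) :
    A.pullback k c ∈ ⨆ (p : ℕ) (q : ℕ) (_ : p + q = k) (_ : r ≤ p) (_ : r ≤ q), A.hodgePQ k p q := by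
  rw [← A.sum_typeProj k c, map_sum]
  refine Submodule.sum_mem _ fun pq _ ↦ ?_
  by_cases hp : pq.1.1 < r
  · rw [A.typeProj_eq_zero_of_mem_hodgeFiltration hF pq hp, map_zero]
    exact Submodule.zero_mem _
  by_cases hq : pq.1.2 < r
  · have h0' : A.typeProj k pq c = 0 := by
      have := congrArg (conjClass (ComplexPoints X) k) (conjClass_typeProj_of_conjClass_eq hX A hreal pq)
      rw [conjClass_conjClass] at this
      rw [this, A.typeProj_eq_zero_of_mem_hodgeFiltration hF
        ⟨pq.1.swap, Finset.HasAntidiagonal.swap_mem_antidiagonal.2 pq.2⟩ hq, conjClass_zero]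
    rw [h0', map_zero]
    exact Submodule.zero_mem _
  · exact Submodule.mem_iSup_of_mem pq.1.1 (Submodule.mem_iSup_of_mem pq.1.2
      (Submodule.mem_iSup_of_mem (Finset.HasAntidiagonal.mem_antidiagonal.1 pq.2)
        (Submodule.mem_iSup_of_mem (not_lt.1 hp) (Submodule.mem_iSup_of_mem (not_lt.1 hq)
          (A.typeProj_mem k pq c)))))

/-! ### The sub-Hodge binder of the crux is load-bearing -/

/-- **`LevelOneConiveauThreefolds` without its sub-Hodge binder is FALSE** (Grothendieck 1969, "for
trivial reasons"). It is not true that for every smooth projective threefold `Y`, Hodge model `A` and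
finite set `s` of rational classes of `H³(Y(ℂ); ℂ)` whose span has Hodge level one
(`⊆ H^{2,1} ⊕ H^{1,2}` in `A`), the span lies in `N¹H³(Y)`: on `Y = E_τ³`, `τ` cubic, there is a
rational class `c ∈ F¹H³` not supported on any divisor
(`Grothendieck1969_generalHodgeConjecture_false_holds`), and a rational class of `F¹` automatically
lies in `H^{2,1} ⊕ H^{1,2}` (`pullback_mem_hodgeConiveau_of_conjClass_eq`), so `s = {c}` refutes the
variant. Hence the binder "`span s` is a sub-Hodge structure" of the crux pair
`LevelOneConiveauThreefolds` / `ConiveauOneFailure` is load-bearing: it is exactly Grothendieck's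
amendment, and the route's barrier `Grothendieck1969_generalHodgeConjecture_false` is respected, not
evaded by accident. [cite: GrothendieckTopology1969, pp. 299–300] [cite: VoisinHodgeI2002, §11.3.2 p. 235] -/
theorem levelOneConiveauThreefolds_false_without_isSubHodge :
    ¬ ∀ ⦃Y : SchemeOver ℂ⦄, IsSmoothProjective 3 Y → ∀ (A : HodgeModel 3 Y)
        (s : Finset (complexBetti Y 3)), (∀ c ∈ s, IsRationalClass c) →
        (Submodule.span ℂ (↑s : Set (complexBetti Y 3))).map (A.pullback 3).hom ≤
          (⨆ (p : ℕ) (q : ℕ) (_ : p + q = 3) (_ : 1 ≤ p) (_ : 1 ≤ q), A.hodgePQ 3 p q) →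
        Submodule.span ℂ (↑s : Set (complexBetti Y 3)) ≤ supportedClasses Y 3 1 := by
  classical
  intro h
  obtain ⟨X, hX, A, c, hc, hF, hN⟩ := Grothendieck1969_generalHodgeConjecture_false_holds.exists_hodgeModel
  refine hN (h hX A {c} (by simpa using hc) ?_ (Submodule.subset_span (by simp)))
  rw [Submodule.map_le_iff_le_comap, Submodule.span_le, Finset.coe_singleton,
    Set.singleton_subset_iff]
  exact pullback_mem_hodgeConiveau_of_conjClass_eq hX A hc.conjClass_eq hF

/-- **The crux's variant without the sub-Hodge binder holds for trivial reasons** — a restatement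
of `levelOneConiveauThreefolds_false_without_isSubHodge` in the shape of `ConiveauOneFailure`: some
smooth projective threefold carries a finite set of rational classes of `H³` whose span has Hodge
level one and is NOT contained in `N¹H³` (namely `E_τ³`, `τ` cubic, with Grothendieck's class). This
does NOT prove the crux `ConiveauOneFailure` (there the span must moreover be a sub-Hodge structure,
which the span of Grothendieck's class is not — its rank is odd); it records that the crux owes its
content to that binder. [cite: GrothendieckTopology1969, pp. 299–300] -/
theorem coniveauOneFailure_variant_without_isSubHodge :
    ∃ (Y : SchemeOver ℂ) (_ : IsSmoothProjective 3 Y) (A : HodgeModel 3 Y)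
      (s : Finset (complexBetti Y 3)),
      (∀ c ∈ s, IsRationalClass c) ∧
      (Submodule.span ℂ (↑s : Set (complexBetti Y 3))).map (A.pullback 3).hom ≤
        (⨆ (p : ℕ) (q : ℕ) (_ : p + q = 3) (_ : 1 ≤ p) (_ : 1 ≤ q), A.hodgePQ 3 p q) ∧
      ¬ Submodule.span ℂ (↑s : Set (complexBetti Y 3)) ≤ supportedClasses Y 3 1 := by
  by_contra hne
  refine levelOneConiveauThreefolds_false_without_isSubHodge fun Y hY A s hs hlev ↦ ?_
  by_contra hN
  exact hne ⟨Y, hY, A, s, hs, hlev, hN⟩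

/-- Sanity (the direction that does hold): `LevelOneConiveauThreefolds` as typed — WITH the sub-Hodge
binder — is implied by the binder-free variant, so the variant's failure is consistent with the crux
pair being open; recorded to make the logical relation explicit. [folklore] -/
theorem levelOneConiveauThreefolds_of_variant_without_isSubHodge
    (h : ∀ ⦃Y : SchemeOver ℂ⦄, IsSmoothProjective 3 Y → ∀ (A : HodgeModel 3 Y)
        (s : Finset (complexBetti Y 3)), (∀ c ∈ s, IsRationalClass c) →
        (Submodule.span ℂ (↑s : Set (complexBetti Y 3))).map (A.pullback 3).hom ≤
          (⨆ (p : ℕ) (q : ℕ) (_ : p + q = 3) (_ : 1 ≤ p) (_ : 1 ≤ q), A.hodgePQ 3 p q) →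
        Submodule.span ℂ (↑s : Set (complexBetti Y 3)) ≤ supportedClasses Y 3 1) :
    LevelOneConiveauThreefolds :=
  fun _ hY A s hs _ hlev ↦ h hY A s hs hlev

end Summit.HodgeConjecture.HodgeConjecture.Theorems

end
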